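import Summits.QuantumFields.BalabanUV.T4Continuum.Support.NE7Route1EndDockedSmallDataGenericLogHR
import Summits.QuantumFields.BalabanUV.T4Continuum.Support.NE7AllMinimisersFluxGradGeneric
import HarnessLib

/-!
# NE7Route1EndDockedSmallDataGenericRegHR — HR TOWER B8: route #1's docked END over the small data with NO socket and NO regularity hypothesis, every `U(n)`, every `L ≥ 2`, (D) block in the `HolderReg` shape
# — the statement of `NE7Route1EndDockedSmallDataGenericLogHR.goodClause_summable_of_route1_docked_smallData_genericLog_HR` with `(c, 0 ≤ c, hreg10)` DELETED ((10)-log := row NE7b's ✓ p811267 `all_minimisers_fluxGrad_generic`)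

Cell `pub-balaban`, rung (B)+1 sub-cell t4, lineage `b2b-balaban-t4-ne7-p1` (CRUX PROVER NE7 #1 = OWNER of BINDER row NE7).  Memo `t4/b2b-balaban-t4-ne7-p1-g110/ROAD-G110.md`
§4–§5 («HR TOWER», OPTION A; INTERFACE REQUEST NE7→NE7b [NE7P1-G110-INBOX-4], split [NE7bP1-G156-INBOX-11]: NE7b B1–B4, owner B5–B9).
WHY.  The END tower of record consumes the term-wise (D) binders `hTA hTB : B11Thm1.Thm1At Cst (fam …)` BY NAME only through the regularity clause (9) at the END's own Hölder
exponent `β₀`; the typed (9) quantifies `∀ β ≤ 1` with one constant `B₄`, which print derives only for `β ≤ β₀ < 1` (cell GAPS C-B8-18) and which no honest realisation of the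
block-average-constrained minimisers can meet at β = 1 once all levels are in the family (junction logarithm, kit j342950, ROAD-G110 §4).  The HR tower re-issues the SAME ENDs on the
CONSUMED shape: concrete backgrounds `VA VB` with per-window `HolderReg … β₀ …` binders (`TermwiseLocalReg.goodClause_summable_UN_levels_of_holderReg`'s (D) block), so that the (D)
block is instantiable by [Balaban1985RegularSpaces] (1.36) at any `β₀ < 1`.  The Thm1At tower stays of record (it is a corollary of this one through
`TermwiseLocalThm1.holderReg_window_family_of_thm1At`).
WHAT ([folklore]; 0 def, 0 sorry).  **`goodClause_summable_of_route1_docked_smallData_genericReg_HR`** = the HR twin of the END of record ✓ p811752; proof = the owner's P3.8 proof verbatim.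
HONEST FRAMING (page 1): composition of landed kernel theorems of rows NE3, NE7, NE7b and of [B7]∕[B8]∕[B11] AS TYPED; nothing of Bałaban's asserted as an axiom; constants
existential; NE3∕NE7 as spine nodes = the dagwriter∕referees' call; FIXED FINITE T⁴, rung (B)+1 — NOT infinite volume, NOT mass gap, NOT BetaPertH, NOT Clay (continuum YM on
T⁴ ⇐ BetaPertH ∧ nine spine estimates).
-/

set_option autoImplicit false

open scoped BigOperators Matrix Matrix.Norms.L2Operator
open Finset NormedSpace MeasureTheory

namespace Summit.QuantumFields.BalabanUV.T4Continuum.NE7Route1EndDockedSmallDataGenericRegHR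

open Literature.MathematicalPhysics.QuantumFieldTheory.Balaban1983to89
open B7Prop1Explicit B7Prop2Explicit B7Prop1Local B11
open T4AveragingDeficitWall hiding Site Plane Plaq Bond
open T4AveragingDeficitWallBoundary (periodBox IsPeriodicCfg)
open MinimalActionSandwich (IsMinimiser)
open MinimalActionRate (Regular sfClass)
open T4OutputRate (Carriers Functional NE9 NE5 LipBackground FadingMemory)
open T4BoundaryCarrier (BFunctional atFl NE9Fl LipBackgroundFl NE5B)
open T4TowerRateComposition (PolyLipGrowth URateUpTo)
open T4CauchySum (InjectedRate)
open T4RecentScale T4GoodClassBudget T4TermwiseBudget T4TermwiseUN T4TermwiseChainUN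
open AveragingDeficitPeriodicCounting (IsPeriodicDir)
open AveragingDeficitTwoLevelPrep (twoLevelSmall)
open NE3EnergyShapes (residualScale IsUnitarySite IsPeriodicSite)
open NE3EnergyWeightedShapes (energyNormW)
open NE7EtaBackgroundCarrier
open TorusSmallFieldGlobalGauge (sectorConst)
open TermwiseBackground (cReg)
open TermwiseHolder (Realises HolderReg)
open T4TermwiseTorus (IsPeriodic pbox)
open NE7Route1EndDockedEnergyWeakHR (goodClause_summable_of_route1_docked_energyW_HR)
open NE7InteriorMinimiserDocking (hminE_of_interior_exists_d4 lines_d4)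

open NE7Route1EndDockedSmallDataGenericLogHR (goodClause_summable_of_route1_docked_smallData_genericLog_HR)
open NE7AllMinimisersFluxGradGeneric (all_minimisers_fluxGrad_generic)

noncomputable section

variable {n : Type} [Fintype n] [DecidableEq n] [Nonempty n]

set_option maxHeartbeats 800000 in
/-- **HR TOWER B8 — ROUTE #1's DOCKED END OVER THE SMALL DATA, NO SOCKET, NO REGULARITY HYPOTHESIS** ((D) block in the `HolderReg` shape) — statement in the file header.
[folklore] -/
theorem goodClause_summable_of_route1_docked_smallData_genericReg_HR {L : ℕ} (hL : 2 ≤ L) :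
    ∃ ε₀ : ℝ, 0 < ε₀ ∧ ∀ {N : ℕ}, 1 ≤ N → ∀ {ε : ℝ}, 0 < ε → ε ≤ ε₀ → ∃ δV : ℝ, 0 < δV ∧ ∀
    -- (A) the bill of NODE O's background coordinate, (H∃) DISCHARGED DOWN TO (8)∃ + ONE numeric `ε`-line (`b = ε`, `g` the explicit letter)
    {θ : ℝ} (hθ : 0 < θ)
    (hθ18 : θ ^ 18 = ((L : ℝ))⁻¹)
    {g : ℝ}
    (hgE : g = (Fintype.card n : ℝ)
          * (624 * ((4 : ℕ) : ℝ) ^ 3 * ε ^ 2 * (1 + (((4 : ℕ) : ℝ) + 1) * ε) ^ 2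
              + 6768 * (Fintype.card (T4AveragingDeficitWall.Plane 4) : ℝ) ^ 2 * (4 : ℕ) * Fintype.card n * ε ^ 4
              + 16 * ((4 : ℕ) : ℝ) ^ 3 * ε ^ 2 * (L : ℝ) ^ 2)
        + 220 * (Fintype.card n : ℝ) * ((4 : ℕ) : ℝ) ^ 3 * ε ^ 3)
    {dom : Set (Site 4 → Fin 4 → (Matrix n n ℂ)ˣ)}
    (hdom : ∀ v ∈ dom, ∀ w : Site 4 → (Matrix n n ℂ)ˣ, IsUnitarySite w → IsPeriodicSite w (N : ℤ) → gaugeAct w v ∈ dom)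
    -- (8)∃ is NOT ASKED: the data class sits inside the small data of radius `δV` supplied by `NE7HintUnconditionalGeneric.hint_small_data_generic` (every `U(n)`, every `L ≥ 2`)
    (hdomδ : ∀ v ∈ dom, IsUnitaryCfg v ∧ IsPeriodicCfg v (N : ℤ) ∧ SmallField v δV)
    -- NEITHER THE SOCKET NOR ANY REGULARITY OF THE MINIMISERS IS ASKED (both are theorems over the small data, for every `U(n)` and every `L ≥ 2`)
    (hsector : (Fintype.card n : ℝ) * (N : ℝ) ^ 2 * ε ≤ sectorConst n)
    {v₁ : (Site 4 → Fin 4 → (Matrix n n ℂ)ˣ)} (hv₁ : v₁ ∈ dom)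
    (D : Type) (sc : D → ℕ) (dl : D → ℝ) (hdl : ∀ X, 0 ≤ dl X) (Fl : Type) (admFl : Set Fl)
    -- (B) window, decay, history moduli, node U2's output on the printed box, the common rate `θ′ ∈ [θ, 1)`
    {W : Set (ℕ → ℝ)} {κ C₉ ω θc Cd γg θ' : ℝ} {Λ : ℕ → ℕ → ℝ} {gA : ℕ → ℕ → ℝ}
    (hΛ : FadingMemory C₉ ω Λ) (hω : 0 ≤ ω)
    (hinj : InjectedRate Cd 0 θc (fun K j => T4CouplingMatching.disc (gA K) (gA (K + 1)) j)) (hCd : 0 ≤ Cd)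
    (hθc : 0 ≤ θc) (hbox : ∀ K i, i ≤ K → 0 < gA K i ∧ gA K i ≤ γg)
    (hgAW : ∀ K, gA K ∈ W) (hgBW : ∀ K, (fun i => gA (K + 1) (i + 1)) ∈ W)
    (hθ' : max ω θc < θ') (hθθ' : θ ≤ θ') (hθ'1 : θ' < 1)
    -- (C) node U3's shapes: E-kind `EA EB`, boundary kind `BA BB`, 𝐑-kind `RA RB` on the boundary carrier over `occCarriers`
    {EA : Functional ({ toCarriers := occCarriers n L N ε dom D sc dl hdl, Fl := Fl, admFl := admFl } :
        T4BoundaryCarrier.Carriers).toCarriers (occCarriers n L N ε dom D sc dl hdl).BgA}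
    {EB : Functional ({ toCarriers := occCarriers n L N ε dom D sc dl hdl, Fl := Fl, admFl := admFl } :
        T4BoundaryCarrier.Carriers).toCarriers (occCarriers n L N ε dom D sc dl hdl).BgB}
    {θ₅ C₅ P : ℝ} {q : ℕ} {CU : (ℕ → ℝ) → ℕ → ℝ}
    (h9 : NE9 EA W κ Λ) (hU : LipBackground EA W κ CU) (hG : PolyLipGrowth CU gA P q) (hP : 0 ≤ P)
    (h5 : NE5 EA EB W κ θ₅ C₅) (hθ₅ : 0 ≤ θ₅) (hC₅ : 0 ≤ C₅) (hθ₅' : θ₅ ≤ θ')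
    {BA : BFunctional ({ toCarriers := occCarriers n L N ε dom D sc dl hdl, Fl := Fl, admFl := admFl } : T4BoundaryCarrier.Carriers)
        (occCarriers n L N ε dom D sc dl hdl).BgA}
    {BB : BFunctional ({ toCarriers := occCarriers n L N ε dom D sc dl hdl, Fl := Fl, admFl := admFl } : T4BoundaryCarrier.Carriers)
        (occCarriers n L N ε dom D sc dl hdl).BgB}
    {θ₅B C₅B PB : ℝ} {qB : ℕ} {CUB : (ℕ → ℝ) → ℕ → ℝ}
    (h9B : NE9Fl BA W κ Λ) (hUBf : LipBackgroundFl BA W κ CUB) (hGB : PolyLipGrowth CUB gA PB qB) (hPB : 0 ≤ PB)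
    (h5B : NE5B BA BB W κ θ₅B C₅B) (hθ₅B : 0 ≤ θ₅B) (hC₅B : 0 ≤ C₅B) (hθ₅B' : θ₅B ≤ θ')
    {RA : Functional ({ toCarriers := occCarriers n L N ε dom D sc dl hdl, Fl := Fl, admFl := admFl } :
        T4BoundaryCarrier.Carriers).toCarriers (occCarriers n L N ε dom D sc dl hdl).BgA}
    {RB : Functional ({ toCarriers := occCarriers n L N ε dom D sc dl hdl, Fl := Fl, admFl := admFl } :
        T4BoundaryCarrier.Carriers).toCarriers (occCarriers n L N ε dom D sc dl hdl).BgB}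
    {θ₅R C₅R PR : ℝ} {qR : ℕ} {CUR : (ℕ → ℝ) → ℕ → ℝ}
    (h9R : NE9 RA W κ Λ) (hUR' : LipBackground RA W κ CUR) (hGR : PolyLipGrowth CUR gA PR qR) (hPR : 0 ≤ PR)
    (h5R : NE5 RA RB W κ θ₅R C₅R) (hθ₅R : 0 ≤ θ₅R) (hC₅R : 0 ≤ C₅R) (hθ₅R' : θ₅R ≤ θ')
    -- (D) the term-wise END's own data and remaining binders (`TermwiseLocalThm1LedgerW` ll.97–242, `ι :=` configurations, `Adm := dom`)
    [MeasurableSpace (Site 4 → Fin 4 → (Matrix n n ℂ)ˣ)] {σ : Type*} [DecidableEq σ] {l₀ vol : ℝ}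
    {T : ℕ → Finset σ} {Bad : ℕ → ℝ → Finset σ} {A B : ℕ → ℝ → σ → ℝ} {μ : ℕ → ℝ → σ → Measure (Site 4 → Fin 4 → (Matrix n n ℂ)ˣ)}
    {fac bfac rfac : ℕ → ℝ → σ → Finset D} {R₁ bβ β' w₀ : ℝ} {κ₀ : ℕ} {gfA gfB : ℕ → ℝ} {gsA gsB : ℕ → ℕ → ℝ}
    {pend : ℕ → ℝ → σ → (Site 4 → Fin 4 → (Matrix n n ℂ)ˣ) → Fl}
    {nA nB aA aB wA wB γA γB : ℕ → ℝ → σ → (Site 4 → Fin 4 → (Matrix n n ℂ)ˣ) → ℝ} {qA qB : ℕ → ℝ}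
    {κ₁ S : ℕ → ℝ → σ → ℕ → ℝ} {cW' RW' : ℕ → ℝ → σ → ℝ} {rw' sw' rγ zA zB c₀' : ℕ → ℝ} {Cw E a Λg Cl CF Ew CrW : ℝ}
    {Y YA : Type*} {Sfib : ℕ → ℝ → σ → (Site 4 → Fin 4 → (Matrix n n ℂ)ˣ) → Set Y}
    {SfibA : ℕ → ℝ → σ → (Site 4 → Fin 4 → (Matrix n n ℂ)ˣ) → Set YA} {gfib : ℕ → ℝ → σ → (Site 4 → Fin 4 → (Matrix n n ℂ)ˣ) → YA → ℝ}
    {f₁ : ℕ → ℝ → σ → (Site 4 → Fin 4 → (Matrix n n ℂ)ˣ) → Y → ℝ}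
    {Q : ℕ → ℝ → σ → (Site 4 → Fin 4 → (Matrix n n ℂ)ˣ) → Y → YA} {yA yB : ℕ → ℝ → σ → (Site 4 → Fin 4 → (Matrix n n ℂ)ˣ) → Y}
    {xA : ℕ → ℝ → σ → (Site 4 → Fin 4 → (Matrix n n ℂ)ˣ) → YA}
    (M : ℕ) (hMtwo : 2 ≤ M) (planes : Finset (Fin 4 × Fin 4))
    (hplanes : ∀ P ∈ planes, P.1 ≠ P.2)
    (VA VB : ℕ → ℝ → σ → (Site 4 → Fin 4 → (Matrix n n ℂ)ˣ) → (B7Prop1Explicit.Site 4 → Fin 4 → (Matrix n n ℂ)ˣ))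
    (lvlA lvlB : ℕ → ℝ → σ → (Site 4 → Fin 4 → (Matrix n n ℂ)ˣ) → (Fin 4 × Fin 4) × B7Prop1Explicit.Site 4 → ℕ)
    {a₀ a₁ a₂ ε₁ β₀ : ℝ}
    (hθ'Λ : θ' ≤ Λg) (hΛ1 : 1 ≤ Λg) (hCl : 0 ≤ Cl)
    -- the residue of the residual-proper factor (W-fmt), read by `hWw′` below
    (wA' wB' : ℕ → ℝ → σ → (Site 4 → Fin 4 → (Matrix n n ℂ)ˣ) → ℝ)
    -- THE EIGHT SELECTION-READING BINDERS, for EVERY selection with the gen-56 specification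
    (hO : ∀ (uA : ℕ → (Site 4 → Fin 4 → (Matrix n n ℂ)ˣ) → (occCarriers n L N ε dom D sc dl hdl).BgA)
        (uB : ℕ → (Site 4 → Fin 4 → (Matrix n n ℂ)ˣ) → (occCarriers n L N ε dom D sc dl hdl).BgB)
        (oneA : (occCarriers n L N ε dom D sc dl hdl).BgA) (oneB : (occCarriers n L N ε dom D sc dl hdl).BgB),
      -- (a) gauge copies of a minimiser pair for the datum itself, at EVERY cutoff, on `dom ∖ {v₁}`
      (∀ K : ℕ, ∀ v ∈ dom, v ≠ v₁ → ∃ (U₁ U₂ : (Site 4 → Fin 4 → (Matrix n n ℂ)ˣ)) (w₁ w₂ : Site 4 → (Matrix n n ℂ)ˣ),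
        IsMinimiser 4 (sfClass 4 L N ε) L N K v U₁ ∧ IsMinimiser 4 (sfClass 4 L N ε) L N (K + 1) v U₂ ∧
        Regular 4 L N ε g (K + 1) U₂ ∧ IsUnitarySite w₁ ∧ IsPeriodicSite w₁ ((N * L ^ K : ℕ) : ℤ) ∧
        IsUnitarySite w₂ ∧ IsPeriodicSite w₂ ((N * L ^ (K + 1) : ℕ) : ℤ) ∧
        (uA K v).1 = (K, gaugeAct w₁ U₁) ∧ (uB K v).1 = (K, gaugeAct w₂ U₂)) →
      -- (b) the reference backgrounds at `v₁` and off `dom`; they are the flat configuration at tag `0`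
      (∀ (K : ℕ) (v : (Site 4 → Fin 4 → (Matrix n n ℂ)ˣ)), ¬ (v ∈ dom ∧ v ≠ v₁) → uA K v = oneA ∧ uB K v = oneB) →
      oneA.1 = ((0 : ℕ), (1 : Site 4 → Fin 4 → (Matrix n n ℂ)ˣ)) → oneB.1 = ((0 : ℕ), (1 : Site 4 → Fin 4 → (Matrix n n ℂ)ˣ)) →
      -- `hfmtA` (l.97)
      (∀ K t τ, A K t τ = ∫ v, (∏ X ∈ fac K t τ,
        Real.exp (EA (gA K) (uA K v) X - EA (gA K) oneA X)) *
          ((∏ X ∈ bfac K t τ, Real.exp (BA (gA K) (uA K v) (pend K t τ v) X)) * nA K t τ v * qA K *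
            ((∏ X ∈ rfac K t τ, Real.exp (RA (gA K) (uA K v) X - RA (gA K) oneA X)) * (Real.exp (-aA K t τ v) * wA K t τ v)))
            ∂(μ K t τ)) ∧
      -- `hfmtB` (l.102)
      (∀ K t τ, B K t τ = ∫ v, (∏ X ∈ fac K t τ,
        Real.exp (EB (fun i => gA (K + 1) (i + 1)) (uB K v) X - EB (fun i => gA (K + 1) (i + 1)) oneB X)) *
          ((∏ X ∈ bfac K t τ, Real.exp (BB (fun i => gA (K + 1) (i + 1)) (uB K v) (pend K t τ v) X)) * nB K t τ v * qB K *
            ((∏ X ∈ rfac K t τ, Real.exp (RB (fun i => gA (K + 1) (i + 1)) (uB K v) X - RB (fun i => gA (K + 1) (i + 1)) oneB X)) *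
              (Real.exp (-aB K t τ v) * wB K t τ v)))
            ∂(μ K t τ)) ∧
      -- `hint` (l.107)
      (∀ K t, |t| ≤ l₀ → ∀ τ ∈ T K \ Bad K t,
        Integrable (fun v => (∏ X ∈ fac K t τ, Real.exp (EA (gA K) (uA K v) X - EA (gA K) oneA X)) *
          ((∏ X ∈ bfac K t τ, Real.exp (BA (gA K) (uA K v) (pend K t τ v) X)) * nA K t τ v * qA K *
            ((∏ X ∈ rfac K t τ, Real.exp (RA (gA K) (uA K v) X - RA (gA K) oneA X)) * (Real.exp (-aA K t τ v) * wA K t τ v))))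
            (μ K t τ) ∧
        Integrable (fun v => (∏ X ∈ fac K t τ,
            Real.exp (EB (fun i => gA (K + 1) (i + 1)) (uB K v) X - EB (fun i => gA (K + 1) (i + 1)) oneB X)) *
          ((∏ X ∈ bfac K t τ, Real.exp (BB (fun i => gA (K + 1) (i + 1)) (uB K v) (pend K t τ v) X)) * nB K t τ v * qB K *
            ((∏ X ∈ rfac K t τ, Real.exp (RB (fun i => gA (K + 1) (i + 1)) (uB K v) X - RB (fun i => gA (K + 1) (i + 1)) oneB X)) *
              (Real.exp (-aB K t τ v) * wB K t τ v))))
            (μ K t τ)) ∧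
      -- `hoff` (l.117)
      (∀ K t, |t| ≤ l₀ → ∀ τ ∈ T K \ Bad K t, ∀ v, v ∉ dom →
        (∏ X ∈ fac K t τ, Real.exp (EA (gA K) (uA K v) X - EA (gA K) oneA X)) *
          ((∏ X ∈ bfac K t τ, Real.exp (BA (gA K) (uA K v) (pend K t τ v) X)) * nA K t τ v * qA K *
            ((∏ X ∈ rfac K t τ, Real.exp (RA (gA K) (uA K v) X - RA (gA K) oneA X)) * (Real.exp (-aA K t τ v) * wA K t τ v)))
            = 0 ∧
        (∏ X ∈ fac K t τ, Real.exp (EB (fun i => gA (K + 1) (i + 1)) (uB K v) X - EB (fun i => gA (K + 1) (i + 1)) oneB X)) *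
          ((∏ X ∈ bfac K t τ, Real.exp (BB (fun i => gA (K + 1) (i + 1)) (uB K v) (pend K t τ v) X)) * nB K t τ v * qB K *
            ((∏ X ∈ rfac K t τ, Real.exp (RB (fun i => gA (K + 1) (i + 1)) (uB K v) X - RB (fun i => gA (K + 1) (i + 1)) oneB X)) *
              (Real.exp (-aB K t τ v) * wB K t τ v)))
            = 0) ∧
      -- `hS` (l.126)
      (∀ K t, |t| ≤ l₀ → ∀ τ ∈ T K \ Bad K t, ∀ v ∈ dom, ∀ j ≤ K,
        |(∑ X ∈ fac K t τ with sc X = j,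
            (Real.log (Real.exp (EB (fun i => gA (K + 1) (i + 1)) (uB K v) X - EB (fun i => gA (K + 1) (i + 1)) oneB X))
              - Real.log (Real.exp (EA (gA K) (uA K v) X - EA (gA K) oneA X)))) - κ₁ K t τ j| ≤ S K t τ j) ∧
      -- `hRSA` (l.148), `hRSB` (l.150)
      (∀ K t, |t| ≤ l₀ → ∀ τ ∈ T K \ Bad K t, ∀ v ∈ dom, ∀ j ≤ K,
        |∑ X ∈ rfac K t τ with sc X = j, (RA (gA K) (uA K v) X - RA (gA K) oneA X)| ≤ vol * (R₁ * gsA K j ^ κ₀)) ∧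
      (∀ K t, |t| ≤ l₀ → ∀ τ ∈ T K \ Bad K t, ∀ v ∈ dom, ∀ j ≤ K,
        |∑ X ∈ rfac K t τ with sc X = j,
          (RB (fun i => gA (K + 1) (i + 1)) (uB K v) X - RB (fun i => gA (K + 1) (i + 1)) oneB X)| ≤ vol * (R₁ * gsB K j ^ κ₀)) ∧
      -- `hWw′` (l.222)
      (∀ K t, |t| ≤ l₀ → ∀ τ ∈ T K \ Bad K t, ∀ v ∈ dom, uA K v = oneA → uB K v = oneB →
        |Real.log (wB' K t τ v) - Real.log (wA' K t τ v) - c₀' K| ≤ vol * sw' K))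
    -- the END's selection-free binders, VERBATIM
    (hsc : ∀ K t, |t| ≤ l₀ → ∀ τ ∈ T K \ Bad K t, ∀ X ∈ fac K t τ, sc X ≤ K)
    (hM : ∀ K t, |t| ≤ l₀ → ∀ τ ∈ T K \ Bad K t,
      Multiplicity (fac K t τ) sc (fun X => Real.exp (-(κ * dl X))) Cw vol Λg K)
    (hvol : 0 ≤ vol) (hE : 0 ≤ E) (ha0 : 0 < a) (ha1 : a < 1)
    (hSle : ∀ K t, |t| ≤ l₀ → ∀ τ ∈ T K \ Bad K t, ∀ j ≤ K, S K t τ j ≤ vol * (E * a ^ (K - j)))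
    (hpend : ∀ K t, |t| ≤ l₀ → ∀ τ ∈ T K \ Bad K t, ∀ v ∈ dom, pend K t τ v ∈ admFl)
    (hBwin : ∀ K t, |t| ≤ l₀ → ∀ τ ∈ T K \ Bad K t, RecentOnly (bfac K t τ) sc (jlogOf Cl K) K)
    (hMB : ∀ K t, |t| ≤ l₀ → ∀ τ ∈ T K \ Bad K t,
      Multiplicity (bfac K t τ) sc (fun X => Real.exp (-(κ * dl X))) Cw vol Λg K)
    (hnpos : ∀ K t, |t| ≤ l₀ → ∀ τ ∈ T K \ Bad K t, ∀ v ∈ dom, 0 < nA K t τ v ∧ 0 < nB K t τ v)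
    (hzA : ∀ K t, |t| ≤ l₀ → ∀ τ ∈ T K \ Bad K t, ∀ v ∈ dom, |Real.log (nA K t τ v)| ≤ vol * zA K)
    (hzB : ∀ K t, |t| ≤ l₀ → ∀ τ ∈ T K \ Bad K t, ∀ v ∈ dom, |Real.log (nB K t τ v)| ≤ vol * zB K)
    (hzAs : Summable zA) (hzBs : Summable zB)
    (hq : ∀ K, 0 < qA K ∧ 0 < qB K)
    (hrsc : ∀ K t, |t| ≤ l₀ → ∀ τ ∈ T K \ Bad K t, ∀ X ∈ rfac K t τ, sc X ≤ K)
    (hMR : ∀ K t, |t| ≤ l₀ → ∀ τ ∈ T K \ Bad K t,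
      Multiplicity (rfac K t τ) sc (fun X => Real.exp (-(κ * dl X))) Cw vol Λg K)
    (hbβ : 0 < bβ) (h031A : ∀ K, Step.Discrete031 bβ β' K (gfA K) (gsA K))
    (h031B : ∀ K, Step.Discrete031 bβ β' K (gfB K) (gsB K)) (hgsA : ∀ K k, k ≤ K → 0 ≤ gsA K k)
    (hgsB : ∀ K k, k ≤ K → 0 ≤ gsB K k) (hR₁ : 0 ≤ R₁) (hκ₀ : 4 < κ₀)
    (hminA : ∀ K t, |t| ≤ l₀ → ∀ τ ∈ T K \ Bad K t, ∀ v ∈ dom, IsMinOn (gfib K t τ v) (SfibA K t τ v) (xA K t τ v))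
    (hQ : ∀ K t, |t| ≤ l₀ → ∀ τ ∈ T K \ Bad K t, ∀ v ∈ dom, Set.MapsTo (Q K t τ v) (Sfib K t τ v) (SfibA K t τ v))
    (hlift : ∀ K t, |t| ≤ l₀ → ∀ τ ∈ T K \ Bad K t, ∀ v ∈ dom,
      yA K t τ v ∈ Sfib K t τ v ∧ Q K t τ v (yA K t τ v) = xA K t τ v)
    (hminB : ∀ K t, |t| ≤ l₀ → ∀ τ ∈ T K \ Bad K t, ∀ v ∈ dom,
      yB K t τ v ∈ Sfib K t τ v ∧ IsMinOn (f₁ K t τ v) (Sfib K t τ v) (yB K t τ v))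
    (hact : ∀ K t, |t| ≤ l₀ → ∀ τ ∈ T K \ Bad K t, ∀ v ∈ dom,
      aA K t τ v = w₀ * gfib K t τ v (xA K t τ v) + γA K t τ v ∧
        aB K t τ v = w₀ * f₁ K t τ v (yB K t τ v) + γB K t τ v)
    (hw₀ : 0 ≤ w₀)
    (hAU : ∀ K t, |t| ≤ l₀ → ∀ τ ∈ T K \ Bad K t, ∀ v ∈ dom,
      (∀ x κ, VA K t τ v x κ ∈ unitaryUnits (Matrix n n ℂ)) ∧
        IsPeriodic (M * L ^ K * L) (VA K t τ v))
    (hBU : ∀ K t, |t| ≤ l₀ → ∀ τ ∈ T K \ Bad K t, ∀ v ∈ dom,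
      (∀ x κ, VB K t τ v x κ ∈ unitaryUnits (Matrix n n ℂ)) ∧
        IsPeriodic (M * L ^ K * L) (VB K t τ v))
    (hA9W : ∀ K t, |t| ≤ l₀ → ∀ τ ∈ T K \ Bad K t, ∀ v ∈ dom, ∀ y ∈ pbox planes (M * L ^ K),
      ∀ x : B7Prop1Explicit.Site 4, InBox ((L : ℤ) • y.2) (deltaHi L ((L : ℤ) • y.2) y.1.1 y.1.2) x →
        HolderReg (VA K t τ v) x 6 (((L : ℝ) ^ lvlA K t τ v y)⁻¹) (a₀ * ε₁) (a₁ * ε₁) β₀ (a₂ * ε₁))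
    (hB9W : ∀ K t, |t| ≤ l₀ → ∀ τ ∈ T K \ Bad K t, ∀ v ∈ dom, ∀ y ∈ pbox planes (M * L ^ K),
      ∀ x : B7Prop1Explicit.Site 4, InBox ((L : ℤ) • y.2) (deltaHi L ((L : ℤ) • y.2) y.1.1 y.1.2) x →
        HolderReg (VB K t τ v) x 6 (((L : ℝ) ^ lvlB K t τ v y)⁻¹) (a₀ * ε₁) (a₁ * ε₁) β₀ (a₂ * ε₁))
    (hwinA : ∀ K t, |t| ≤ l₀ → ∀ τ ∈ T K \ Bad K t, ∀ v ∈ dom,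
      RecentOnly (pbox planes (M * L ^ K)) (lvlA K t τ v) (jlogOf Cl K) K)
    (hwinB : ∀ K t, |t| ≤ l₀ → ∀ τ ∈ T K \ Bad K t, ∀ v ∈ dom,
      RecentOnly (pbox planes (M * L ^ K)) (lvlB K t τ v) (jlogOf Cl K) K)
    (ha₀ : 0 ≤ a₀) (ha₁ : 0 ≤ a₁) (ha₂ : 0 ≤ a₂) (hε₁ : 0 ≤ ε₁) (hε₁1 : ε₁ ≤ 1)
    (hsmall : 20480 * (L : ℝ) ^ 2 * (cReg a₀ a₁ * ε₁) ≤ 1) (hβ₀ : 0 < β₀) (hβ₀1 : β₀ ≤ 1)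
    (hreprU : ∀ K t, |t| ≤ l₀ → ∀ τ ∈ T K \ Bad K t, ∀ v ∈ dom,
      f₁ K t τ v (yA K t τ v) = ∑ x ∈ pbox planes (M * L ^ K * L), eN (phiU (VA K t τ v) x) ∧
        gfib K t τ v (xA K t τ v) = ∑ y ∈ pbox planes (M * L ^ K), eN (psiU L (VA K t τ v) y))
    (hreprL : ∀ K t, |t| ≤ l₀ → ∀ τ ∈ T K \ Bad K t, ∀ v ∈ dom,
      f₁ K t τ v (yB K t τ v) = ∑ x ∈ pbox planes (M * L ^ K * L), eN (phiU (VB K t τ v) x) ∧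
        gfib K t τ v (Q K t τ v (yB K t τ v)) = ∑ y ∈ pbox planes (M * L ^ K), eN (psiU L (VB K t τ v) y))
    (hMvol : ((M : ℝ)) ^ 4 ≤ vol)
    (hγ : ∀ K t, |t| ≤ l₀ → ∀ τ ∈ T K \ Bad K t, ∀ v ∈ dom, |γB K t τ v - γA K t τ v| ≤ vol * rγ K)
    (hrγ : Summable rγ)
    -- the residual-proper factor's format (W-fmt) and inputs (W-sc)(W-loc)(W-size)(W-rate-t)(W-mult-F)(W-win)(W-rate-0)(W-mult)
    (wfac nf : ℕ → ℝ → σ → Finset D) (wfac₀ : ℕ → Finset D)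
    (vcA vcB : ℕ → ℝ → D → ℝ) (hEw : 0 ≤ Ew) (hCrW : 0 ≤ CrW)
    (hwA : ∀ K t, |t| ≤ l₀ → ∀ τ ∈ T K \ Bad K t, ∀ v ∈ dom,
      wA K t τ v = wA' K t τ v * Real.exp (∑ X ∈ wfac K t τ, vcA K t X))
    (hwB : ∀ K t, |t| ≤ l₀ → ∀ τ ∈ T K \ Bad K t, ∀ v ∈ dom,
      wB K t τ v = wB' K t τ v * Real.exp (∑ X ∈ wfac K t τ, vcB K t X))
    (hw'pos : ∀ K t, |t| ≤ l₀ → ∀ τ ∈ T K \ Bad K t, ∀ v ∈ dom, 0 < wA' K t τ v ∧ 0 < wB' K t τ v)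
    (hRw' : ∀ K t, |t| ≤ l₀ → ∀ τ ∈ T K \ Bad K t, ∀ v ∈ dom,
      |Real.log (wB' K t τ v) - Real.log (wA' K t τ v) - cW' K t τ| ≤ RW' K t τ)
    (hRRw' : ∀ K t, |t| ≤ l₀ → ∀ τ ∈ T K \ Bad K t, RW' K t τ ≤ vol * rw' K) (hrw' : Summable rw')
    (hsw' : Summable sw')
    (hWsc : ∀ K t, |t| ≤ l₀ → ∀ τ ∈ T K \ Bad K t, ∀ X ∈ wfac K t τ, sc X ≤ K)
    (hWsc₀ : ∀ K, ∀ X ∈ wfac₀ K, sc X ≤ K)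
    (hWloc : ∀ K t, |t| ≤ l₀ → ∀ τ ∈ T K \ Bad K t, ∀ X ∈ wfac K t τ, X ∉ nf K t τ →
      vcA K t X = vcA K 0 X ∧ vcB K t X = vcB K 0 X)
    (hWsize : ∀ K t, |t| ≤ l₀ → ∀ τ ∈ T K \ Bad K t, ∀ j ≤ K,
      ∑ X ∈ wfac K t τ with sc X = j, (|vcA K t X - vcA K 0 X| + |vcB K t X - vcB K 0 X|)
        ≤ vol * (Ew * a ^ (K - j)))
    (hWratet : ∀ K t, |t| ≤ l₀ → ∀ τ ∈ T K \ Bad K t, ∀ X ∈ wfac K t τ, X ∈ nf K t τ →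
      |(vcB K t X - vcB K 0 X) - (vcA K t X - vcA K 0 X)| ≤ CrW * θ' ^ sc X * Real.exp (-(κ * dl X)))
    (hWMF : ∀ K t, |t| ≤ l₀ → ∀ τ ∈ T K \ Bad K t,
      Multiplicity (nf K t τ) sc (fun X => Real.exp (-(κ * dl X))) CF vol Λg K)
    (hWwin : ∀ K t, |t| ≤ l₀ → ∀ τ ∈ T K \ Bad K t, ∀ X ∈ wfac K t τ, X ∉ wfac₀ K → jlogOf Cl K ≤ sc X)
    (hWwin₀ : ∀ K t, |t| ≤ l₀ → ∀ τ ∈ T K \ Bad K t, ∀ X ∈ wfac₀ K, X ∉ wfac K t τ → jlogOf Cl K ≤ sc X)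
    (hWrate0 : ∀ K t, |t| ≤ l₀ → ∀ τ ∈ T K \ Bad K t, ∀ X ∈ wfac K t τ,
      |vcB K 0 X - vcA K 0 X| ≤ CrW * θ' ^ sc X * Real.exp (-(κ * dl X)))
    (hWrate0' : ∀ K, ∀ X ∈ wfac₀ K, |vcB K 0 X - vcA K 0 X| ≤ CrW * θ' ^ sc X * Real.exp (-(κ * dl X)))
    (hWM : ∀ K t, |t| ≤ l₀ → ∀ τ ∈ T K \ Bad K t,
      Multiplicity (wfac K t τ) sc (fun X => Real.exp (-(κ * dl X))) Cw vol Λg K)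
    (hWM₀ : ∀ K, Multiplicity (wfac₀ K) sc (fun X => Real.exp (-(κ * dl X))) Cw vol Λg K),
    ∃ δ : ℕ → ℝ, GoodClause l₀ vol T A B Bad δ ∧ Summable δ := by
  obtain ⟨ε₁, hε₁, H1⟩ := goodClause_summable_of_route1_docked_smallData_genericLog_HR (n := n) hL
  obtain ⟨ε₂, hε₂, H2⟩ := all_minimisers_fluxGrad_generic (n := n) hL
  refine ⟨min ε₁ ε₂, lt_min hε₁ hε₂, ?_⟩
  intro N hN ε hε hεle
  obtain ⟨δ₁, hδ₁, H1'⟩ := H1 hN hε (hεle.trans (min_le_left _ _))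
  haveI : NeZero N := ⟨by omega⟩
  obtain ⟨c, hc, H2'⟩ := H2 ε hε (hεle.trans (min_le_right _ _))
  obtain ⟨δ₂, hδ₂, Hreg⟩ := H2' N hN
  refine ⟨min δ₁ δ₂, lt_min hδ₁ hδ₂, ?_⟩
  intro θ hθ hθ18 g hgE dom hdom hdomδ
  -- the two radii of the small data
  have hdomδ₁ : ∀ v ∈ dom, IsUnitaryCfg v ∧ IsPeriodicCfg v (N : ℤ) ∧ SmallField v δ₁ := fun v hv =>
    ⟨(hdomδ v hv).1, (hdomδ v hv).2.1, MinimalActionRate.SmallField.mono (hdomδ v hv).2.2 (min_le_left _ _)⟩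
  have hdom₂ : ∀ v ∈ dom, v ∈ {V : Site 4 → Fin 4 → (Matrix n n ℂ)ˣ | IsUnitaryCfg V ∧ IsPeriodicCfg V (N : ℤ) ∧ SmallField V δ₂} := fun v hv =>
    ⟨(hdomδ v hv).1, (hdomδ v hv).2.1, MinimalActionRate.SmallField.mono (hdomδ v hv).2.2 (min_le_right _ _)⟩
  -- (10) TYPE UP TO A LOGARITHM IS A THEOREM FOR EVERY MINIMISER OVER THE SMALL DATA, every `U(n)`, every `L ≥ 2` (row NE7b's `all_minimisers_fluxGrad_generic`)
  have hreg10 : ∀ V ∈ dom, ∀ (k : ℕ) (U : Site 4 → Fin 4 → (Matrix n n ℂ)ˣ), IsMinimiser 4 (sfClass 4 L N ε) L N k V U →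
      ∀ (x : Site 4) (κ : Fin 4) (π : T4AveragingDeficitWall.Plane 4), ‖covGrad U (flux U) x κ π‖ ≤ c * (1 + (k : ℝ)) / ((L : ℝ) ^ k) ^ 3 :=
    fun V hV k U hmin x κ π => Hreg V (hdom₂ V hV) k U hmin x κ π
  exact H1' hθ hθ18 hgE hdom hdomδ₁ c hc hreg10

end

end Summit.QuantumFields.BalabanUV.T4Continuum.NE7Route1EndDockedSmallDataGenericRegHR
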